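import Mathlib
import Summits.Ventures.PercRepro2.ThreeTermPartLaw
import Summits.Ventures.PercRepro2.TypedMaskStar

/-!
# Three-terminal parts, IV: the star is a part — its typed partition law, and the `(2,2,2)`-star
base from the partition-world certificate
(blind cell PercRepro2, night-3 g29, 2026-08-29; `proofs/NIGHT3-CERT.md` §38 — the bridge
«`8³`-table = `5³`-table ∘ `π8`» of g28's NOT DONE (iii), in the kernel)

A star at an unmarked vertex `u` with the three typed edges `e₁ = {u, t₁}`, `e₂ = {u, t₂}`,
`e₃ = {u, t₃}` and no other edge at `u` is a three-terminal part with `W = {u}` and `S = {e₁, e₂, e₃}`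
(`isPart_star`).  Its star configuration `cfg e₁ e₂ e₃ i` has the PATTERN `clique i` — the pairs of
terminals both of whose star edges are open (`pat_cfg`, through p2's `conn_star_iff`): this is the
connectivity fact behind §36.2's gadget law for a star, «the open star edges merge their ends».  So the
part's typed partition law is the explicit `starLaw (τ e₁) (τ e₂) (τ e₃)` on `Fin 8` (`partLaw_star`),
and for the `(2,2,2)`-star the typed Harris condition follows from g28's `72` evaluations
`gen8_sum_nonneg` (`typedHarris_star222`: `πpat ∘ clique = π8`), whence

* **`typedCount_star222_nonneg'`**: if the PART GRAPH's table (the core with the three virtual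
  terminal edges — the `5³`-partition table of §36.2 / §37.5 read on `8` patterns) lies in the Harris
  cone `InConeP πpat`, the typed base of core + `(2,2,2)`-star is nonnegative.  Compared with
  `TypedStarCone.typedCount_star222_nonneg` (p739048, the certificate read on the `8³` STAR-configuration
  table) this is the certificate of g28's certlp.py (the partition table), and the same statement is
  available for every star type pattern through `partLaw_star` once its law passes the typed Harris
  check.

Own work; standard axioms.
-/

namespace Summit.Ventures.PercRepro2

open SepPair Block ThreeTerm TypedStar CovForm.TypedRed.Mask

namespace Part

section Star

variable {V : Type*} {E : Type*} [Fintype E] [DecidableEq E] [DecidableEq V]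

/-- The clique pattern of a star configuration: bit `0` = both edges at `t₁, t₂` open, bit `1` = both at
`t₁, t₃`, bit `2` = both at `t₂, t₃`. -/
def clique (i : Fin 8) : Fin 8 :=
  ⟨bit 0 i * bit 1 i + 2 * (bit 0 i * bit 2 i) + 4 * (bit 1 i * bit 2 i), by
    have h0 := bit_le_one 0 i
    have h1 := bit_le_one 1 i
    have h2 := bit_le_one 2 i
    interval_cases bit 0 i <;> interval_cases bit 1 i <;> interval_cases bit 2 i <;> omega⟩

/-- The partition map of the pattern world composed with the clique pattern is the star map `π8`. -/
lemma πpat_clique : ∀ i : Fin 8, πpat (clique i) = π8 i := by decide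

/-- Bit `0` of the clique pattern. -/
lemma clique_bit0 : ∀ i : Fin 8, decide (bit 0 i = 1 ∧ bit 1 i = 1) = decide (bit 0 (clique i) = 1) := by
  decide

/-- Bit `1` of the clique pattern. -/
lemma clique_bit1 : ∀ i : Fin 8, decide (bit 0 i = 1 ∧ bit 2 i = 1) = decide (bit 1 (clique i) = 1) := by
  decide

/-- Bit `2` of the clique pattern. -/
lemma clique_bit2 : ∀ i : Fin 8, decide (bit 1 i = 1 ∧ bit 2 i = 1) = decide (bit 2 (clique i) = 1) := by
  decide

/-- The star's typed partition law: typed triples of star configurations by clique patterns. -/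
def starLaw (t₀ t₁ t₂ : ℕ) (i j k : Fin 8) : ℚ :=
  ∑ a : Fin 8, ∑ b : Fin 8, ∑ c : Fin 8,
    if ((bit 0 a + bit 0 b + bit 0 c = t₀ ∧ bit 1 a + bit 1 b + bit 1 c = t₁ ∧
        bit 2 a + bit 2 b + bit 2 c = t₂) ∧ (clique a = i ∧ clique b = j ∧ clique c = k)) then 1 else 0

variable {ends : E → Sym2 V} {u t₁ t₂ t₃ : V} {e₁ e₂ e₃ : E}
  (he₁ : ends e₁ = s(u, t₁)) (he₂ : ends e₂ = s(u, t₂)) (he₃ : ends e₃ = s(u, t₃))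
  (ht₁ : t₁ ≠ u) (ht₂ : t₂ ≠ u) (ht₃ : t₃ ≠ u) (h12 : t₁ ≠ t₂) (h13 : t₁ ≠ t₃) (h23 : t₂ ≠ t₃)
  (hd12 : e₁ ≠ e₂) (hd13 : e₁ ≠ e₃) (hd23 : e₂ ≠ e₃)
  (hS : ∀ e, e ∈ ({e₁, e₂, e₃} : Finset E) ↔ e ∈ touches ends {u})

include he₁ he₂ he₃ ht₁ ht₂ ht₃ hS in
omit [Fintype E] [DecidableEq V] in
/-- **A star is a three-terminal part** (`W = {u}`). -/
lemma isPart_star : IsPart ends {u} t₁ t₂ t₃ where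
  t₁_notMem := by simpa using ht₁
  t₂_notMem := by simpa using ht₂
  t₃_notMem := by simpa using ht₃
  ends_mem := by
    intro e he x y hxy
    have he' : e ∈ ({e₁, e₂, e₃} : Finset E) := (hS e).2 he
    simp only [Finset.mem_insert, Finset.mem_singleton] at he'
    rcases he' with rfl | rfl | rfl
    · rw [he₁, Sym2.eq_iff] at hxy
      rcases hxy with ⟨rfl, rfl⟩ | ⟨rfl, rfl⟩ <;> simp
    · rw [he₂, Sym2.eq_iff] at hxy
      rcases hxy with ⟨rfl, rfl⟩ | ⟨rfl, rfl⟩ <;> simp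
    · rw [he₃, Sym2.eq_iff] at hxy
      rcases hxy with ⟨rfl, rfl⟩ | ⟨rfl, rfl⟩ <;> simp

omit [Fintype E] [DecidableEq V] in
/-- The restriction to `S` of a configuration supported on the star is itself. -/
lemma restrictTo_cfg (i : Fin 8) :
    SepPair.restrictTo (↑({e₁, e₂, e₃} : Finset E)) (cfg e₁ e₂ e₃ i) = cfg e₁ e₂ e₃ i := by
  funext e
  by_cases he : e ∈ ({e₁, e₂, e₃} : Finset E)
  · exact restrictTo_apply_of_mem (Finset.mem_coe.2 he)
  · rw [restrictTo_apply_of_notMem (fun h => he (Finset.mem_coe.1 h))]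
    simp only [Finset.mem_insert, Finset.mem_singleton, not_or] at he
    exact (cfg_other e₁ e₂ e₃ i he.1 he.2.1 he.2.2).symm

include he₁ he₂ he₃ ht₁ ht₂ ht₃ hd12 hd13 hd23 in
omit [Fintype E] in
/-- Two terminals are joined inside the star iff both their star edges are open. -/
lemma conn_cfg_iff (i : Fin 8) {x y : V} {ex ey : E} (hx : x ≠ u) (hy : y ≠ u) (hxy : x ≠ y)
    (hex : ex = e₁ ∧ x = t₁ ∨ ex = e₂ ∧ x = t₂ ∨ ex = e₃ ∧ x = t₃)
    (hey : ey = e₁ ∧ y = t₁ ∨ ey = e₂ ∧ y = t₂ ∨ ey = e₃ ∧ y = t₃)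
    (h12 : t₁ ≠ t₂) (h13 : t₁ ≠ t₃) (h23 : t₂ ≠ t₃) :
    Conn ends (cfg e₁ e₂ e₃ i) x y ↔ cfg e₁ e₂ e₃ i ex = true ∧ cfg e₁ e₂ e₃ i ey = true := by
  rw [conn_star_iff he₁ he₂ he₃ ht₁ ht₂ ht₃ (fun e h1 h2 h3 => cfg_other e₁ e₂ e₃ i h1 h2 h3) hx hy hxy]
  rw [mem_nbrs, mem_nbrs]
  rcases hex with ⟨rfl, rfl⟩ | ⟨rfl, rfl⟩ | ⟨rfl, rfl⟩ <;>
    rcases hey with ⟨rfl, rfl⟩ | ⟨rfl, rfl⟩ | ⟨rfl, rfl⟩ <;>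
    first
    | exact absurd rfl hxy
    | simp [h12, h13, h23, h12.symm, h13.symm, h23.symm]

include he₁ he₂ he₃ ht₁ ht₂ ht₃ h12 h13 h23 hd12 hd13 hd23 in
omit [Fintype E] in
/-- The part map of a star configuration is the star configuration of its clique pattern. -/
lemma pm_cfg (i : Fin 8) :
    pm ends (↑({e₁, e₂, e₃} : Finset E)) e₁ e₂ e₃ t₁ t₂ t₃ (cfg e₁ e₂ e₃ i) =
      cfg e₁ e₂ e₃ (clique i) := by
  have hα : blockObs ends (↑({e₁, e₂, e₃} : Finset E)) t₁ t₂ (cfg e₁ e₂ e₃ i) =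
      decide (bit 0 i = 1 ∧ bit 1 i = 1) := by
    unfold blockObs
    rw [restrictTo_cfg, decide_eq_decide]
    rw [conn_cfg_iff he₁ he₂ he₃ ht₁ ht₂ ht₃ hd12 hd13 hd23 i ht₁ ht₂ h12 (Or.inl ⟨rfl, rfl⟩)
      (Or.inr (Or.inl ⟨rfl, rfl⟩)) h12 h13 h23]
    rw [cfg_s0, cfg_s1 e₁ e₂ e₃ hd12]
    simp
  have hβ : blockObs ends (↑({e₁, e₂, e₃} : Finset E)) t₁ t₃ (cfg e₁ e₂ e₃ i) =
      decide (bit 0 i = 1 ∧ bit 2 i = 1) := by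
    unfold blockObs
    rw [restrictTo_cfg, decide_eq_decide]
    rw [conn_cfg_iff he₁ he₂ he₃ ht₁ ht₂ ht₃ hd12 hd13 hd23 i ht₁ ht₃ h13 (Or.inl ⟨rfl, rfl⟩)
      (Or.inr (Or.inr ⟨rfl, rfl⟩)) h12 h13 h23]
    rw [cfg_s0, cfg_s2 e₁ e₂ e₃ hd13 hd23]
    simp
  have hγ : blockObs ends (↑({e₁, e₂, e₃} : Finset E)) t₂ t₃ (cfg e₁ e₂ e₃ i) =
      decide (bit 1 i = 1 ∧ bit 2 i = 1) := by
    unfold blockObs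
    rw [restrictTo_cfg, decide_eq_decide]
    rw [conn_cfg_iff he₁ he₂ he₃ ht₁ ht₂ ht₃ hd12 hd13 hd23 i ht₂ ht₃ h23 (Or.inr (Or.inl ⟨rfl, rfl⟩))
      (Or.inr (Or.inr ⟨rfl, rfl⟩)) h12 h13 h23]
    rw [cfg_s1 e₁ e₂ e₃ hd12, cfg_s2 e₁ e₂ e₃ hd13 hd23]
    simp
  funext e
  unfold pm partMap
  by_cases he1 : e = e₁
  · rw [if_pos he1, hα, he1, cfg_s0, clique_bit0]
  by_cases he2 : e = e₂
  · rw [if_neg he1, if_pos he2, hβ, he2, cfg_s1 e₁ e₂ e₃ hd12, clique_bit1]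
  by_cases he3 : e = e₃
  · rw [if_neg he1, if_neg he2, if_pos he3, hγ, he3, cfg_s2 e₁ e₂ e₃ hd13 hd23, clique_bit2]
  rw [if_neg he1, if_neg he2, if_neg he3, cfg_other e₁ e₂ e₃ (clique i) he1 he2 he3]
  split_ifs
  · rfl
  · exact cfg_other e₁ e₂ e₃ i he1 he2 he3

include he₁ he₂ he₃ ht₁ ht₂ ht₃ h12 h13 h23 hd12 hd13 hd23 in
omit [Fintype E] in
/-- **The pattern of a star configuration is its clique pattern.** -/
lemma pat_cfg (i : Fin 8) :
    pat ends {e₁, e₂, e₃} e₁ e₂ e₃ t₁ t₂ t₃ (cfg e₁ e₂ e₃ i) = clique i := by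
  unfold pat
  rw [pm_cfg he₁ he₂ he₃ ht₁ ht₂ ht₃ h12 h13 h23 hd12 hd13 hd23 i]
  exact bits_cfg e₁ e₂ e₃ hd12 hd13 hd23 (clique i)

include he₁ he₂ he₃ ht₁ ht₂ ht₃ h12 h13 h23 hd12 hd13 hd23 in
/-- **The star's typed partition law is `starLaw`.** -/
lemma partLaw_star (τ : E → ℕ) (i j k : Fin 8) :
    partLaw {e₁, e₂, e₃} τ (pat ends {e₁, e₂, e₃} e₁ e₂ e₃ t₁ t₂ t₃) i j k =
      starLaw (τ e₁) (τ e₂) (τ e₃) i j k := by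
  unfold partLaw starLaw
  -- nest the support conditions
  have hn : ∀ a b c : Config E,
      (if ((SuppOn ({e₁, e₂, e₃} : Finset E) a ∧ SuppOn {e₁, e₂, e₃} b ∧ SuppOn {e₁, e₂, e₃} c) ∧
          (∀ e ∈ ({e₁, e₂, e₃} : Finset E), openCount a b c e = τ e)) ∧
          (pat ends {e₁, e₂, e₃} e₁ e₂ e₃ t₁ t₂ t₃ a = i ∧ pat ends {e₁, e₂, e₃} e₁ e₂ e₃ t₁ t₂ t₃ b = j ∧
            pat ends {e₁, e₂, e₃} e₁ e₂ e₃ t₁ t₂ t₃ c = k) then (1 : ℚ) else 0) =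
      (if SuppOn ({e₁, e₂, e₃} : Finset E) a then (if SuppOn ({e₁, e₂, e₃} : Finset E) b then
        (if SuppOn ({e₁, e₂, e₃} : Finset E) c then
          (if (∀ e ∈ ({e₁, e₂, e₃} : Finset E), openCount a b c e = τ e) ∧
            (pat ends {e₁, e₂, e₃} e₁ e₂ e₃ t₁ t₂ t₃ a = i ∧ pat ends {e₁, e₂, e₃} e₁ e₂ e₃ t₁ t₂ t₃ b = j ∧
              pat ends {e₁, e₂, e₃} e₁ e₂ e₃ t₁ t₂ t₃ c = k) then (1 : ℚ) else 0) else 0) else 0)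
        else 0) := by
    intro a b c
    by_cases ha : SuppOn ({e₁, e₂, e₃} : Finset E) a
    · by_cases hb : SuppOn ({e₁, e₂, e₃} : Finset E) b
      · by_cases hc : SuppOn ({e₁, e₂, e₃} : Finset E) c
        · rw [if_pos ha, if_pos hb, if_pos hc]
          by_cases hr : (∀ e ∈ ({e₁, e₂, e₃} : Finset E), openCount a b c e = τ e) ∧
            (pat ends {e₁, e₂, e₃} e₁ e₂ e₃ t₁ t₂ t₃ a = i ∧ pat ends {e₁, e₂, e₃} e₁ e₂ e₃ t₁ t₂ t₃ b = j ∧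
              pat ends {e₁, e₂, e₃} e₁ e₂ e₃ t₁ t₂ t₃ c = k)
          · rw [if_pos ⟨⟨⟨ha, hb, hc⟩, hr.1⟩, hr.2⟩, if_pos hr]
          · rw [if_neg (fun h => hr ⟨h.1.2, h.2⟩), if_neg hr]
        · rw [if_neg (fun h => hc h.1.1.2.2), if_pos ha, if_pos hb, if_neg hc]
      · rw [if_neg (fun h => hb h.1.1.2.1), if_pos ha, if_neg hb]
    · rw [if_neg (fun h => ha h.1.1.1), if_neg ha]
  simp only [hn, sum_ite_const']
  rw [sum_suppOn_star e₁ e₂ e₃ hd12 hd13 hd23]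
  refine Finset.sum_congr rfl fun a _ => ?_
  rw [sum_suppOn_star e₁ e₂ e₃ hd12 hd13 hd23]
  refine Finset.sum_congr rfl fun b _ => ?_
  rw [sum_suppOn_star e₁ e₂ e₃ hd12 hd13 hd23]
  refine Finset.sum_congr rfl fun c _ => ?_
  obtain ⟨o0, o1, o2⟩ := openCount_cfg e₁ e₂ e₃ hd12 hd13 hd23 a b c
  have hp : ∀ x : Fin 8, pat ends {e₁, e₂, e₃} e₁ e₂ e₃ t₁ t₂ t₃ (cfg e₁ e₂ e₃ x) = clique x :=
    pat_cfg he₁ he₂ he₃ ht₁ ht₂ ht₃ h12 h13 h23 hd12 hd13 hd23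
  have hc : (∀ e ∈ ({e₁, e₂, e₃} : Finset E),
      openCount (cfg e₁ e₂ e₃ a) (cfg e₁ e₂ e₃ b) (cfg e₁ e₂ e₃ c) e = τ e) ↔
      (bit 0 a + bit 0 b + bit 0 c = τ e₁ ∧ bit 1 a + bit 1 b + bit 1 c = τ e₂ ∧
        bit 2 a + bit 2 b + bit 2 c = τ e₃) := by
    simp only [Finset.mem_insert, Finset.mem_singleton, forall_eq_or_imp, forall_eq, o0, o1, o2]
  by_cases hcond : (∀ e ∈ ({e₁, e₂, e₃} : Finset E),
      openCount (cfg e₁ e₂ e₃ a) (cfg e₁ e₂ e₃ b) (cfg e₁ e₂ e₃ c) e = τ e) ∧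
      (pat ends {e₁, e₂, e₃} e₁ e₂ e₃ t₁ t₂ t₃ (cfg e₁ e₂ e₃ a) = i ∧
        pat ends {e₁, e₂, e₃} e₁ e₂ e₃ t₁ t₂ t₃ (cfg e₁ e₂ e₃ b) = j ∧
        pat ends {e₁, e₂, e₃} e₁ e₂ e₃ t₁ t₂ t₃ (cfg e₁ e₂ e₃ c) = k)
  · have h2 := hcond.2
    rw [hp, hp, hp] at h2
    rw [if_pos hcond, if_pos ⟨hc.1 hcond.1, h2⟩]
  · rw [if_neg hcond]
    rw [if_neg]
    intro h
    apply hcond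
    refine ⟨hc.2 h.1, ?_⟩
    rw [hp, hp, hp]
    exact h.2

/-- A sum over `Fin 8` of a fibre indicator of `clique` and of a second index collapses. -/
lemma sum_clique_fibre (f : Fin 8 → Fin 8 → ℚ) (b' c' : Fin 8) :
    (∑ b : Fin 8, ∑ c : Fin 8, if clique b' = b ∧ clique c' = c then f b c else 0) =
      f (clique b') (clique c') := by
  rw [Fintype.sum_eq_single (clique b') (fun b hb => Finset.sum_eq_zero fun c _ => by simp [Ne.symm hb])]
  rw [Fintype.sum_eq_single (clique c') (fun c hc => by simp [Ne.symm hc])]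
  simp

/-- Commuting two outer sums past three inner sums. -/
lemma sum5_comm {B C A' B' C' : Type*} [Fintype B] [Fintype C] [Fintype A'] [Fintype B'] [Fintype C']
    (f : B → C → A' → B' → C' → ℚ) :
    (∑ b, ∑ c, ∑ a', ∑ b', ∑ c', f b c a' b' c') = ∑ a', ∑ b', ∑ c', ∑ b, ∑ c, f b c a' b' c' :=
  calc (∑ b, ∑ c, ∑ a', ∑ b', ∑ c', f b c a' b' c')
      = ∑ u : B × C, ∑ y : A' × B' × C', f u.1 u.2 y.1 y.2.1 y.2.2 := by
        simp only [Fintype.sum_prod_type]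
    _ = ∑ y : A' × B' × C', ∑ u : B × C, f u.1 u.2 y.1 y.2.1 y.2.2 := Finset.sum_comm
    _ = ∑ a', ∑ b', ∑ c', ∑ b, ∑ c, f b c a' b' c' := by
        simp only [Fintype.sum_prod_type]

/-- **The typed Harris condition for the `(2,2,2)`-star law**, from g28's `72` evaluations. -/
theorem typedHarris_star222 : TypedHarris πpat (starLaw 2 2 2) := by
  intro a s
  unfold starLaw
  -- move the generator coefficients inside and collapse the pattern fibres
  have step : ∀ b c : Fin 8, hq s (πpat b) (πpat c) *
      (∑ a' : Fin 8, ∑ b' : Fin 8, ∑ c' : Fin 8,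
        if ((bit 0 a' + bit 0 b' + bit 0 c' = 2 ∧ bit 1 a' + bit 1 b' + bit 1 c' = 2 ∧
            bit 2 a' + bit 2 b' + bit 2 c' = 2) ∧ (clique a' = a ∧ clique b' = b ∧ clique c' = c))
          then (1 : ℚ) else 0) =
      ∑ a' : Fin 8, ∑ b' : Fin 8, ∑ c' : Fin 8,
        if clique b' = b ∧ clique c' = c then
          (if typed8 a' b' c' ∧ clique a' = a then hq s (πpat b) (πpat c) else 0) else 0 := by
    intro b c
    simp only [Finset.mul_sum]
    refine Finset.sum_congr rfl fun a' _ => Finset.sum_congr rfl fun b' _ =>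
      Finset.sum_congr rfl fun c' _ => ?_
    simp only [typed8]
    split_ifs <;> simp_all
  simp only [step]
  rw [sum5_comm]
  refine Finset.sum_nonneg fun a' _ => ?_
  simp only [sum_clique_fibre, πpat_clique]
  by_cases ha : clique a' = a
  · simp only [ha, and_true]
    refine le_of_le_of_eq (gen8_sum_nonneg a' s) ?_
    refine Finset.sum_congr rfl fun b' _ => Finset.sum_congr rfl fun c' _ => ?_
    split_ifs <;> simp
  · simp [ha]

include he₁ he₂ he₃ ht₁ ht₂ ht₃ h12 h13 h23 hd12 hd13 hd23 hS in
/-- **The typed `(2,2,2)`-star base from the partition-world certificate**: if the part graph's table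
(the core with the three virtual terminal edges) lies in the Harris cone of the pattern world, the typed
base of core + `(2,2,2)`-star is nonnegative. -/
theorem typedCount_star222_nonneg' {o a₁ a₂ a₃ b : V} (ho : o ≠ u) (ha₁ : a₁ ≠ u) (ha₂ : a₂ ≠ u)
    (ha₃ : a₃ ≠ u) (hb : b ≠ u) {F : Finset E} (hd : Disjoint F {e₁, e₂, e₃}) (z : Config E)
    (τ : E → ℕ) (hτ1 : τ e₁ = 2) (hτ2 : τ e₂ = 2) (hτ3 : τ e₃ = 2)
    (hcone : InConeP πpat (cubicOf (partTable ends {e₁, e₂, e₃} e₁ e₂ e₃ t₁ t₂ t₃ o a₁ a₂ a₃ b F z τ))) :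
    0 ≤ typedCount (F ∪ {e₁, e₂, e₃}) z τ (CovForm.K3 (R := ℚ) ends o a₁ a₂ a₃ b) := by
  have hlaw : partLaw {e₁, e₂, e₃} τ (pat ends {e₁, e₂, e₃} e₁ e₂ e₃ t₁ t₂ t₃) = starLaw 2 2 2 := by
    funext i j k
    rw [partLaw_star he₁ he₂ he₃ ht₁ ht₂ ht₃ h12 h13 h23 hd12 hd13 hd23 τ i j k, hτ1, hτ2, hτ3]
  refine typedCount_part_nonneg (isPart_star he₁ he₂ he₃ ht₁ ht₂ ht₃ hS) hS (by simp) (by simp) (by simp)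
    hd12 hd13 hd23 (by simpa using ho) (by simpa using ha₁) (by simpa using ha₂) (by simpa using ha₃)
    (by simpa using hb) hd z τ hcone ?_
  rw [hlaw]
  exact typedHarris_star222

end Star

end Part

end Summit.Ventures.PercRepro2
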